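import Summits.AnomalousDissipation.AnomalousDissipation.Theorems.SolenoidalFractalHomogenisationLagrangianStepVmodDistortedDefs
import Summits.AnomalousDissipation.AnomalousDissipation.Theorems.SolenoidalFractalHomogenisationLagrangianStepZ7GlueEulerThetaDefs
import Summits.AnomalousDissipation.AnomalousDissipation.Theorems.SolenoidalFractalHomogenisationLagrangianStepOneLevelSplitDefsH
import Summits.AnomalousDissipation.AnomalousDissipation.Theorems.SolenoidalFractalHomogenisationRealisedQuasiStaticCellLawSectorReduction
import Summits.AnomalousDissipation.AnomalousDissipation.Theorems.SolenoidalFractalHomogenisationRealisedQuasiStaticCellLawSingleMode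
import Literature.Analysis.FluidPDE.PassiveVectorTensorLipschitzTest
import HarnessLib

/-!
# CERTIFIER 3-PROBE (planner ad-ideate-p5 g16) of p1 g16's candidate text `HighLabelDecayWthg` (D28-19 trigger (T-a)).
Scratch file, NOT a tree file.  The candidate def is copied VERBATIM into the probe namespace; probes:
(P1) θW = 0 degeneration BOTH WAYS: `HighLabelDecayWthg … 0 ↔ HighLabelDecayW …` (bridges `toDistorted_one` / `of_one_toFlat`, `distort_one`);
(P2) non-vacuity of the `G₀`-solenoidal datum binders at a NON-identity frame (single mode, `p ⊥ G₀ᵀℓ`-type condition);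
(P3) quantifier order = `SlowVectorClauseFθg`'s frame prefix (by `rfl`-level inspection; antitone in θW as p1's `highLabelDecayWthg_mono_θW`);
(P4) the v29 slot texts of D28-19 (3)/D28-19′ (a): `Xθgw`, `Xθgw_mono_ν₀`, `vmod_E_textHTX_anti` (+ the superseded-by-weaker certificate),
`stub_W7thg` ⇒ `stub_highLabelDecay_IS` (rung), and the composition `hXw := ⟨hX, hW⟩` at the design instance.
-/

set_option linter.dupNamespace false

namespace Summit.AnomalousDissipation.AnomalousDissipation.Theorems.SolenoidalFractalHomogenisation.LagrangianStep.P5ProbeWthg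

open Literature.Analysis Literature.Analysis.FluidPDE Literature.Analysis.FunctionSpaces
open MeasureTheory Set
open scoped InnerProductSpace

noncomputable section

/-- p1 g16's candidate, verbatim (HOME/ad-sawtooth-k1loc-p1/g16/HighLabelDecayWthg-candidate.lean). -/
def HighLabelDecayWthg {k : ℕ} (W : LatticeShear.LatticeWord k) (M : ℝ) (hM : 0 < M) (lo hi Λ β ν₀ Kb CK cK θW : ℝ) : Prop :=
  ∀ θ ∈ Set.Icc 0 θW, ∀ G₀ : Matrix (Fin 3) (Fin 3) ℝ, G₀.det = 1 → (∀ i j, |G₀ i j - (1 : Matrix (Fin 3) (Fin 3) ℝ) i j| ≤ θ) →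
  ∀ ν, ∀ hν : ν ∈ Set.Ioo 0 ν₀, ∀ n : ℕ, 1 ≤ n → ∀ 𝔸 : Torus.Visc4 (Fin 3),
    Torus.OddSmall 𝔸 (ν * β) → (∃ lam ∈ Set.Icc (1:ℝ) Λ, Torus.NearIso 𝔸 (ν * (lo / lam)) (ν * (hi * lam))) →
    ∀ L > (0:ℝ), (n : ℝ) * ν ≤ Kb * L →
    ∀ F : VF, FunctionSpaces.Torus.MemSobolev 1 (FunctionSpaces.EuclideanSpace.complexify ∘ F) → FunctionSpaces.Torus.HasZeroMean F →
      FunctionSpaces.Torus.IsWeaklyDivFree (Torus.distort (fun _ => G₀) F) →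
      (∀ k' : Fin 3 → ℤ, (∃ ℓ z : Fin 3 → ℤ, ‖Torus.latticeVec ℓ‖ < L ∧ k' = ℓ + (n : ℤ) • z) → ∀ i, modeCoeff k' F i = 0) →
      ∀ T > (0:ℝ), ∀ u : ℝ → VF,
        Torus.IsWeakTensorPassiveVectorDistortedOn 0 T ((1 / (n:ℝ) ^ 2) • 𝔸) (cellField W M hM ν hν.1 n) (fun _ _ => G₀) F u →
        ∀ᵐ t ∂(volume.restrict (Ioo 0 T)),
          ∫ x, ‖u t x‖ ^ 2 ≤ CK * Real.exp (-(2 * cK * ν * t)) * ∫ x, ‖F x‖ ^ 2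

/-! ## (P1) θW = 0 degeneration, both directions -/

/-- (P1a) The graded clause at radius `0` gives the flat clause `HighLabelDecayW` (take `θ = 0`, `G₀ = 1`; a flat weak solution is a
`G ≡ 1` distorted one by `IsWeakTensorPassiveVectorOn.toDistorted_one`, the datum is `L²` by `H¹ ⊆ L²`). -/
theorem highLabelDecayW_of_wthg_zero {k : ℕ} {W : LatticeShear.LatticeWord k} {M : ℝ} {hM : 0 < M} {lo hi Λ β ν₀ Kb CK cK θW : ℝ}
    (hθW : 0 ≤ θW) (h : HighLabelDecayWthg W M hM lo hi Λ β ν₀ Kb CK cK θW) : HighLabelDecayW W M hM lo hi Λ β ν₀ Kb CK cK := by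
  intro ν hν n hn 𝔸 hodd hwin L hL hKL F hF hlab T hT u hu
  have h1 : ∀ i j, |(1 : Matrix (Fin 3) (Fin 3) ℝ) i j - (1 : Matrix (Fin 3) (Fin 3) ℝ) i j| ≤ (0:ℝ) := fun i j => by simp
  have hdiv : FunctionSpaces.Torus.IsWeaklyDivFree (Torus.distort (fun _ => (1 : Matrix (Fin 3) (Fin 3) ℝ)) F) := by
    rw [Torus.distort_one]; exact hF.2.2
  have hF2 : MemLp F 2 volume := RealisedQuasiStaticCellLaw.memLp_two_of_memSobolev_one_complexify hF.1
  exact h 0 ⟨le_rfl, hθW⟩ 1 Matrix.det_one h1 ν hν n hn 𝔸 hodd hwin L hL hKL F hF.1 hF.2.1 hdiv hlab T hT u (hu.toDistorted_one hF2)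

/-- (P1b) Conversely the flat clause IS the radius-`0` rung: `|G₀ − 1| ≤ 0` forces `G₀ = 1`, and a `G ≡ 1` distorted solution is flat
(`IsWeakTensorPassiveVectorDistortedOn.of_one_toFlat`). -/
theorem wthg_zero_of_highLabelDecayW {k : ℕ} {W : LatticeShear.LatticeWord k} {M : ℝ} {hM : 0 < M} {lo hi Λ β ν₀ Kb CK cK : ℝ}
    (h : HighLabelDecayW W M hM lo hi Λ β ν₀ Kb CK cK) : HighLabelDecayWthg W M hM lo hi Λ β ν₀ Kb CK cK 0 := by
  intro θ hθ G₀ _hdet hG ν hν n hn 𝔸 hodd hwin L hL hKL F hF1 hF2 hF3 hlab T hT u hu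
  have hθ0 : θ = 0 := le_antisymm hθ.2 hθ.1
  have hG1 : G₀ = 1 := by
    ext i j
    have := hG i j; rw [hθ0] at this
    have := abs_nonpos_iff.mp this
    linarith [this, sub_eq_zero.mp this]
  subst hG1
  have hF3' : FunctionSpaces.Torus.IsWeaklyDivFree F := by rwa [Torus.distort_one] at hF3
  have hu' : Torus.IsWeakTensorPassiveVectorOn 0 T ((1 / (n:ℝ) ^ 2) • 𝔸) (cellField W M hM ν hν.1 n) F u :=
    Torus.IsWeakTensorPassiveVectorDistortedOn.of_one_toFlat (by simpa using hu)
  exact h ν hν n hn 𝔸 hodd hwin L hL hKL F ⟨hF1, hF2, hF3'⟩ hlab T hT u hu'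

/-- (P1) packaged: the radius-`0` rung is exactly the flat clause. -/
theorem wthg_zero_iff {k : ℕ} {W : LatticeShear.LatticeWord k} {M : ℝ} {hM : 0 < M} {lo hi Λ β ν₀ Kb CK cK : ℝ} :
    HighLabelDecayWthg W M hM lo hi Λ β ν₀ Kb CK cK 0 ↔ HighLabelDecayW W M hM lo hi Λ β ν₀ Kb CK cK :=
  ⟨highLabelDecayW_of_wthg_zero le_rfl, wthg_zero_of_highLabelDecayW⟩

/-! ## (P2) non-vacuity of the datum binders at a non-identity unimodular frame -/

/-- The shear frame `G₀ = 1 + θ·E₀₁` (unimodular, `max|G₀ − 1| = θ`). -/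
def shearFrame (θ : ℝ) : Matrix (Fin 3) (Fin 3) ℝ := 1 + θ • Matrix.single 0 1 (1:ℝ)

theorem shearFrame_det (θ : ℝ) : (shearFrame θ).det = 1 := by
  simp [shearFrame, Matrix.det_fin_three, Matrix.single, Matrix.one_apply]

theorem shearFrame_near (θ : ℝ) (hθ : 0 ≤ θ) : ∀ i j, |shearFrame θ i j - (1 : Matrix (Fin 3) (Fin 3) ℝ) i j| ≤ θ := by
  intro i j
  fin_cases i <;> fin_cases j <;> simp [shearFrame, Matrix.single, Matrix.one_apply, abs_of_nonneg hθ, hθ]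

/-- A constant frame distorts a single mode into the single mode with rotated polarisation. -/
theorem distort_const_singleMode (G₀ : Matrix (Fin 3) (Fin 3) ℝ) (ℓ : Fin 3 → ℤ) (p : EuclideanSpace ℝ (Fin 3)) :
    Torus.distort (fun _ => G₀) (fun x : UnitAddTorus (Fin 3) => (UnitAddTorus.mFourier ℓ x).re • p)
      = fun x => (UnitAddTorus.mFourier ℓ x).re • (WithLp.toLp 2 (G₀.mulVec (WithLp.ofLp p)) : EuclideanSpace ℝ (Fin 3)) := by
  funext x
  simp only [Torus.distort, WithLp.ofLp_smul, Matrix.mulVec_smul, WithLp.toLp_smul]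

/-- (P2) NON-VACUITY: for the shear frame with `θ = 1/10` the single mode `ℓ = (0, 5, 0)` with polarisation `p = e₀` (note `p` is NOT
`⊥`-adjusted: `G₀ p = e₀ ⊥ latticeVec ℓ`) satisfies the three datum binders of `HighLabelDecayWthg` — `H¹`, zero mean, `G₀`-solenoidal —
and carries no modes other than `±ℓ` (so the high-label binder holds for every `L ≤ 5 = ‖ℓ‖` with `n > 10`, e.g. `n = 20`, `L = 5`, `ν ≤ Kb/4`). -/
theorem datum_binders_nonvacuous :
    let G₀ := shearFrame (1/10)
    let ℓ : Fin 3 → ℤ := ![0, 5, 0]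
    let p : EuclideanSpace ℝ (Fin 3) := EuclideanSpace.single 0 1
    let F : VF := fun x => (UnitAddTorus.mFourier ℓ x).re • p
    G₀.det = 1 ∧ (∀ i j, |G₀ i j - (1 : Matrix (Fin 3) (Fin 3) ℝ) i j| ≤ 1/10) ∧
    FunctionSpaces.Torus.MemSobolev 1 (FunctionSpaces.EuclideanSpace.complexify ∘ F) ∧ FunctionSpaces.Torus.HasZeroMean F ∧
    FunctionSpaces.Torus.IsWeaklyDivFree (Torus.distort (fun _ => G₀) F) := by
  refine ⟨shearFrame_det _, shearFrame_near _ (by norm_num), RealisedQuasiStaticCellLaw.memSobolev_one_singleMode _ _,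
    RealisedQuasiStaticCellLaw.hasZeroMean_singleMode (by decide) _, ?_⟩
  rw [distort_const_singleMode]
  refine RealisedQuasiStaticCellLaw.isWeaklyDivFree_singleMode _ ?_
  -- ⟪G₀ e₀, latticeVec ℓ⟫ = ⟪e₀, (0,5,0)⟫ = 0
  have hG : (shearFrame (1/10)).mulVec (WithLp.ofLp (EuclideanSpace.single 0 (1:ℝ) : EuclideanSpace ℝ (Fin 3))) = Pi.single 0 1 := by
    ext i; fin_cases i <;> simp [shearFrame, Matrix.mulVec, dotProduct, Fin.sum_univ_three, Matrix.single, Matrix.one_apply]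
  rw [hG, EuclideanSpace.inner_eq_star_dotProduct]
  simp [Torus.latticeVec_apply, dotProduct, Fin.sum_univ_three]

/-! ## (P4) the v29 slot texts of RULING D28-19 (3) / D28-19′ (a): `Xθgw`, `Xθgw_mono_ν₀`, `vmod_E_textHTX_anti`, and the composition `hXw := ⟨hX, hW⟩` -/

/-- `Z7Glue.Xθgw` as announced (D28-19 (3)): the (V_θg) binder AND the graded frozen-frame W7 family. -/
def Xθgw {k : ℕ} (W : LatticeShear.LatticeWord k) (M : ℝ) (hM : 0 < M) (c : ℝ) (Φ : ℝ → Torus.Visc4 (Fin 3) → Torus.Visc4 (Fin 3))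
    (lo hi Λ β σ C ν₀ K : ℝ) : Prop :=
  Z7Glue.Xθg W M hM c Φ lo hi Λ β σ C ν₀ K ∧
    (∀ Kb : ℝ, 1 ≤ Kb → ∃ CK : ℝ, 1 ≤ CK ∧ ∃ cK > (0:ℝ), ∃ νh > (0:ℝ), ∃ θW > (0:ℝ), HighLabelDecayWthg W M hM lo hi Λ β νh Kb CK cK θW)

/-- `Xθgw_mono_ν₀` (shape of `Z7Glue.Xθg_mono_ν₀`; the W-conjunct is `ν₀`-free). -/
theorem Xθgw_mono_ν₀ {k : ℕ} (W : LatticeShear.LatticeWord k) (M : ℝ) (hM : 0 < M) (c : ℝ) (Φ : ℝ → Torus.Visc4 (Fin 3) → Torus.Visc4 (Fin 3))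
    (lo hi Λ β σ C ν₀ ν₀' K : ℝ) (hle : ν₀' ≤ ν₀) (h : Xθgw W M hM c Φ lo hi Λ β σ C ν₀ K) :
    Xθgw W M hM c Φ lo hi Λ β σ C ν₀' K :=
  ⟨Z7Glue.Xθg_mono_ν₀ W M hM c Φ lo hi Λ β σ C ν₀ ν₀' K hle h.1, h.2⟩

/-- `vmod_E_textHTX_anti` (D28-19 (3)): the text is ANTITONE in the extra binder `X` (a stronger `X'` gives a weaker obligation). One line. -/
theorem vmod_E_textHTX_anti
    {X X' : ∀ {k : ℕ}, LatticeShear.LatticeWord k → (M : ℝ) → 0 < M → ℝ → (ℝ → Torus.Visc4 (Fin 3) → Torus.Visc4 (Fin 3)) → ℝ → ℝ → ℝ → ℝ → ℝ → ℝ → ℝ → ℝ → Prop}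
    (hXX : ∀ {k : ℕ} (W : LatticeShear.LatticeWord k) (M : ℝ) (hM : 0 < M) (c : ℝ) (Φ : ℝ → Torus.Visc4 (Fin 3) → Torus.Visc4 (Fin 3)) (lo hi Λ β σ C ν₀ K : ℝ),
      X' W M hM c Φ lo hi Λ β σ C ν₀ K → X W M hM c Φ lo hi Λ β σ C ν₀ K)
    {e : ℝ → ℝ} (h : Z7Glue.Vmod_E_textHTX X e) : Z7Glue.Vmod_E_textHTX X' e := by
  intro k W M hM c hc Φ lo hi Λ β σ C ν₀ K hlo hlo1 hhi hΛ hβ hσ hC hν₀ hν₀1 hK hV hX hH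
  exact h k W M hM c hc Φ lo hi Λ β σ C ν₀ K hlo hlo1 hhi hΛ hβ hσ hC hν₀ hν₀1 hK hV (hXX W M hM c Φ lo hi Λ β σ C ν₀ K hX) hH

/-- The superseded-by-WEAKER certificate `stub_Vmod_EHTthg ↦ stub_Vmod_EHTthgw` is `vmod_E_textHTX_anti (fun … h => h.1)`. -/
example {e : ℝ → ℝ} (h : Z7Glue.Vmod_E_textHTX Z7Glue.Xθg e) : Z7Glue.Vmod_E_textHTX Xθgw e :=
  vmod_E_textHTX_anti (X := Z7Glue.Xθg) (X' := Xθgw) (fun _ _ _ _ _ _ _ _ _ _ _ _ _ h => h.1) h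

/-- `stub_W7thg`'s registry text (D28-19′ (a)) as a Prop — the graded twin of the v4 registered-and-proved `stub_highLabelDecay_IS`. -/
def StubW7thg : Prop :=
  ∀ (M : ℝ) (hM : 0 < M) (lo hi Λ β : ℝ), 0 < lo → lo ≤ 1 → 1 ≤ hi → 1 < Λ → 0 ≤ β →
    ∀ Kb : ℝ, 1 ≤ Kb → ∃ CK : ℝ, 1 ≤ CK ∧ ∃ cK > (0:ℝ), ∃ ν₀ > (0:ℝ), ∃ θW > (0:ℝ),
      HighLabelDecayWthg Summit.AnomalousDissipation.AnomalousDissipation.Theorems.cubatureWord M hM lo hi Λ β ν₀ Kb CK cK θW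

/-- The flat family (H) text of `stub_highLabelDecay_IS` (v28 l.1047) as a Prop. -/
def StubHighLabelDecayIS : Prop :=
  ∀ (M : ℝ) (hM : 0 < M) (lo hi Λ β : ℝ), 0 < lo → lo ≤ 1 → 1 ≤ hi → 1 < Λ → 0 ≤ β →
    ∀ Kb : ℝ, 1 ≤ Kb → ∃ CK : ℝ, 1 ≤ CK ∧ ∃ cK > (0:ℝ), ∃ ν₀ > (0:ℝ),
      HighLabelDecayW Summit.AnomalousDissipation.AnomalousDissipation.Theorems.cubatureWord M hM lo hi Λ β ν₀ Kb CK cK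

/-- RUNG CHECK: `stub_W7thg` is a strengthening of the registered-and-proved flat W7 (it re-proves it through the radius-0 bridge) — so the
new registered producer is NOT implied by anything in the tree (it is the graded content), and its θW ↓ 0 shadow is exactly (H). -/
theorem stubHighLabelDecayIS_of_stubW7thg (h : StubW7thg) : StubHighLabelDecayIS := by
  intro M hM lo hi Λ β hlo hlo1 hhi hΛ hβ Kb hKb
  obtain ⟨CK, hCK, cK, hcK, ν₀, hν₀, θW, hθW, hW⟩ := h M hM lo hi Λ β hlo hlo1 hhi hΛ hβ Kb hKb
  exact ⟨CK, hCK, cK, hcK, ν₀, hν₀, highLabelDecayW_of_wthg_zero hθW.le hW⟩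

/-- COMPOSITION CHECK (D28-19′ (a) «hXw := ⟨hX, hW⟩»): at the design instance the slot `Xθgw cubatureWord …` is assembled from the (V_θg)
producer's output `hX` and `stub_W7thg`, with the SAME `Λ` (= the ΛV at which `hX` is supplied) — binder bookkeeping elaborates. -/
example (hW7 : StubW7thg) (M : ℝ) (hM : 0 < M) (c : ℝ) (Φ : ℝ → Torus.Visc4 (Fin 3) → Torus.Visc4 (Fin 3)) (lo hi ΛV β σ C ν₀ K : ℝ)
    (hlo : 0 < lo) (hlo1 : lo ≤ 1) (hhi : 1 ≤ hi) (hΛV : 1 < ΛV) (hβ : 0 ≤ β)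
    (hX : Z7Glue.Xθg Summit.AnomalousDissipation.AnomalousDissipation.Theorems.cubatureWord M hM c Φ lo hi ΛV β σ C ν₀ K) :
    Xθgw Summit.AnomalousDissipation.AnomalousDissipation.Theorems.cubatureWord M hM c Φ lo hi ΛV β σ C ν₀ K :=
  ⟨hX, hW7 M hM lo hi ΛV β hlo hlo1 hhi hΛV hβ⟩


end

end Summit.AnomalousDissipation.AnomalousDissipation.Theorems.SolenoidalFractalHomogenisation.LagrangianStep.P5ProbeWthg
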